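import Literature.Analysis.Fourier.HilbertTransformLineInvPowSpan
import Literature.Analysis.Fourier.HilbertTransformLineSplit
import Summits.NavierStokesRegularity.OSWSelfSimilar.SheetRCayleySubstitution
import Mathlib.Analysis.Complex.Trigonometric
import HarnessLib

/-!
# SHEET-ℝ frame, item (E2): `H e_n = −(1 + cos θ)·cos nθ`, `H[(1 + cos θ)cos nθ] = e_n`, `𝒰e_n = −(L/n)·sin nθ`

HONEST FRAMING (cell ns-blowup GROUP B / zone Z3, case Z3-SR-CERT; 1-D MODEL certificate frame; not Euler/NS).

The certificate frame of the ℝ point (cert-1 `SHEET-R-PRICE-impl1.md` §1) uses, in the Cayley variable `ξ = L tan(θ/2)`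
(`θ = θ(ξ) = 2·arctan(ξ/L)`, `L > 0`), the frame functions `e_n(ξ) = (1 + cos θ)·sin nθ` and the EXACT action of the line Hilbert
transform `H` (`Literature.Analysis.Fourier.hilbertTransform`, convention `H cos = sin`) on them:

  **(E2)  `H e_n = −(1 + cos θ)·cos nθ`,  `𝒰e_n := ∫₀^ξ H e_n = −(L/n)·sin nθ`  (`n ≥ 1`).**

This file is the kernel form of (E2). Mechanism (selfsim g7 DESIGN NOTE, STATUS 2026-08-26 15:22Z): with `w = L − iξ`,
`e^{iθ} = (L + iξ)/(L − iξ)` and `1 + cos θ = 2L²/((L + iξ)(L − iξ))`, so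

  `(1 + cos θ)·e^{inθ} = 2L²(L + iξ)^{n−1} w^{−(n+1)} = ∑_{j<n} 2L²·C(n−1,j)(2L)^j(−1)^{n−1−j} · w^{−(j+2)}`,

a finite REAL combination of `w^{-2}, …, w^{-(n+1)}`; on that span `H(Re F) = Im F`, `H(Im F) = −Re F`
(`Literature.Analysis.Fourier.hilbertTransform_cayleySum`, from `hilbertTransform_cayleyInvPow`: the functions `w^{-k}` are upper-half-plane
boundary values, King 2009 App. 1 Table 1.2 (2.2)). Taking imaginary / real parts gives (E2) and its cosine companion; the `n = 0`
companion `H[1 + cos θ] = sin θ` (Poisson pair) shows the cosine clause genuinely needs `n ≥ 1`. The velocity clause and the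
`lineHilbert`/`lineVelocity` spellings of the gCLM files then follow from cert-5's substitution file `SheetRCayleySubstitution`
(§4 smoothness/integrability of `e_n`, §5 `∫₀^x (1 + cos θ)cos nθ = (L/n) sin nθ`). Pure calculus about explicit functions; no
definition, no named fact, nothing asserted about any profile. MODEL frame bookkeeping only.
-/

noncomputable section

namespace Summit.NavierStokesRegularity.OSWSelfSimilar
namespace SheetRCayleyHilbert

open _root_.MeasureTheory _root_.Set _root_.Filter _root_.Complex Literature.Analysis.Fourier
open scoped Real Topology

/-! ### §1 The Cayley frame in rational form -/

/-- In the Cayley variable `θ = 2·arctan(ξ/L)`: **`e^{iθ} = (L + iξ)/(L − iξ)`** (`L > 0`). [folklore] -/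
theorem cexp_cayleyAngle_mul_I {L : ℝ} (hL : 0 < L) (ξ : ℝ) :
    Complex.exp (((2 * Real.arctan (ξ / L) : ℝ) : ℂ) * I) = ((L : ℂ) + I * ξ) / ((L : ℂ) - I * ξ) := by
  have hw := cayleyDen_ne_zero hL ξ
  have hL0 : L ≠ 0 := hL.ne'
  have h2 : L ^ 2 + ξ ^ 2 ≠ 0 := by positivity
  rw [eq_div_iff hw, Complex.exp_mul_I, ← Complex.ofReal_cos, ← Complex.ofReal_sin,
    SheetRCayleySubstitution.cos_cayleyAngle hL0, SheetRCayleySubstitution.sin_cayleyAngle hL0]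
  apply Complex.ext
  · simp only [Complex.mul_re, Complex.add_re, Complex.add_im, Complex.mul_im, Complex.sub_re, Complex.sub_im,
      Complex.ofReal_re, Complex.ofReal_im, Complex.I_re, Complex.I_im, zero_mul, mul_zero, sub_zero, add_zero,
      mul_one, zero_sub, zero_add, one_mul]
    field_simp
    ring
  · simp only [Complex.mul_re, Complex.add_re, Complex.add_im, Complex.mul_im, Complex.sub_re, Complex.sub_im,
      Complex.ofReal_re, Complex.ofReal_im, Complex.I_re, Complex.I_im, zero_mul, mul_zero, sub_zero, add_zero,
      mul_one, zero_sub, zero_add, one_mul]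
    field_simp
    ring

/-- `(L + iξ)(L − iξ) = L² + ξ²`. [folklore] -/
theorem cayleyDen_conj_mul (L ξ : ℝ) : ((L : ℂ) + I * ξ) * ((L : ℂ) - I * ξ) = ((L ^ 2 + ξ ^ 2 : ℝ) : ℂ) := by
  push_cast
  ring_nf
  rw [Complex.I_sq]
  ring

/-- **The Cayley frame in rational form**: for `θ = 2·arctan(ξ/L)` and `n = m + 1 ≥ 1`,
`(1 + cos θ)·e^{inθ} = 2L²·(L + iξ)^m·(L − iξ)^{−(m+2)}`. [folklore] -/
theorem frame_cexp_eq_rational {L : ℝ} (hL : 0 < L) (m : ℕ) (ξ : ℝ) :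
    ((1 + Real.cos (2 * Real.arctan (ξ / L)) : ℝ) : ℂ) *
        Complex.exp (((((m + 1 : ℕ) : ℝ) * (2 * Real.arctan (ξ / L)) : ℝ) : ℂ) * I)
      = 2 * (L : ℂ) ^ 2 * ((L : ℂ) + I * ξ) ^ m * (((L : ℂ) - I * ξ) ^ (m + 2))⁻¹ := by
  have hw := cayleyDen_ne_zero hL ξ
  have hw' : (L : ℂ) + I * ξ ≠ 0 := by
    intro h
    have := congrArg Complex.re h
    simp at this
    exact hL.ne' this
  have hexp : Complex.exp (((((m + 1 : ℕ) : ℝ) * (2 * Real.arctan (ξ / L)) : ℝ) : ℂ) * I)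
      = (((L : ℂ) + I * ξ) / ((L : ℂ) - I * ξ)) ^ (m + 1) := by
    rw [← cexp_cayleyAngle_mul_I hL, ← Complex.exp_nat_mul]
    push_cast
    ring_nf
  have hcos : (((1 + Real.cos (2 * Real.arctan (ξ / L)) : ℝ) : ℂ)) =
      2 * (L : ℂ) ^ 2 / (((L : ℂ) + I * ξ) * ((L : ℂ) - I * ξ)) := by
    rw [SheetRCayleySubstitution.one_add_cos_cayleyAngle hL.ne', cayleyDen_conj_mul]
    push_cast
    rfl
  rw [hexp, hcos, div_pow, div_mul_div_comm, eq_mul_inv_iff_mul_eq₀ (pow_ne_zero _ hw), div_mul_eq_mul_div,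
    div_eq_iff (mul_ne_zero (mul_ne_zero hw' hw) (pow_ne_zero _ hw))]
  ring

/-- **Binomial expansion into the `L¹` span**: with `w = L − iξ` and `L + iξ = 2L − w`,
`2L²(L + iξ)^m w^{−(m+2)} = ∑_{j ≤ m} 2L²·C(m,j)·(2L)^j·(−1)^{m−j} · w^{−(j+2)}` — a finite REAL combination of `w^{-2}, …, w^{-(m+2)}`.
[folklore] -/
theorem frame_rational_eq_sum {L : ℝ} (hL : 0 < L) (m : ℕ) (ξ : ℝ) :
    2 * (L : ℂ) ^ 2 * ((L : ℂ) + I * ξ) ^ m * (((L : ℂ) - I * ξ) ^ (m + 2))⁻¹ =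
      ∑ j ∈ Finset.range (m + 1),
        ((2 * L ^ 2 * (m.choose j : ℝ) * (2 * L) ^ j * (-1) ^ (m - j) : ℝ) : ℂ) *
          (((L : ℂ) - I * ξ) ^ (j + 2))⁻¹ := by
  have hw := cayleyDen_ne_zero hL ξ
  have ha : (L : ℂ) + I * ξ = 2 * L + -((L : ℂ) - I * ξ) := by ring
  rw [ha, add_pow, Finset.mul_sum, Finset.sum_mul]
  refine Finset.sum_congr rfl fun j hj => ?_
  have hj' : j ≤ m := Nat.lt_succ_iff.mp (Finset.mem_range.mp hj)
  rw [neg_pow, show m + 2 = (m - j) + (j + 2) by omega, pow_add]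
  push_cast
  field_simp

/-- The companion function `(1 + cos θ)·cos nθ` (`n = m + 1`) is the REAL part of the rational sum. [folklore] -/
theorem coframe_eq_re {L : ℝ} (hL : 0 < L) (m : ℕ) (ξ : ℝ) :
    (1 + Real.cos (2 * Real.arctan (ξ / L))) * Real.cos (((m + 1 : ℕ) : ℝ) * (2 * Real.arctan (ξ / L))) =
      (∑ j ∈ Finset.range (m + 1),
        ((2 * L ^ 2 * (m.choose j : ℝ) * (2 * L) ^ j * (-1) ^ (m - j) : ℝ) : ℂ) *
          (((L : ℂ) - I * ξ) ^ (j + 2))⁻¹).re := by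
  rw [← frame_rational_eq_sum hL, ← frame_cexp_eq_rational hL, Complex.re_ofReal_mul, Complex.exp_ofReal_mul_I_re]

/-- The frame function `e_n = (1 + cos θ)·sin nθ` (`n = m + 1`) is the IMAGINARY part of the rational sum. [folklore] -/
theorem frame_eq_im {L : ℝ} (hL : 0 < L) (m : ℕ) (ξ : ℝ) :
    (1 + Real.cos (2 * Real.arctan (ξ / L))) * Real.sin (((m + 1 : ℕ) : ℝ) * (2 * Real.arctan (ξ / L))) =
      (∑ j ∈ Finset.range (m + 1),
        ((2 * L ^ 2 * (m.choose j : ℝ) * (2 * L) ^ j * (-1) ^ (m - j) : ℝ) : ℂ) *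
          (((L : ℂ) - I * ξ) ^ (j + 2))⁻¹).im := by
  rw [← frame_rational_eq_sum hL, ← frame_cexp_eq_rational hL, Complex.im_ofReal_mul, Complex.exp_ofReal_mul_I_im]

/-! ### §2 (E2): the Hilbert transform of the frame -/

/-- **(E2), sine frame: `H[(1 + cos θ) sin nθ] = −(1 + cos θ) cos nθ`** for every `n ≥ 1` (`θ = 2·arctan(ξ/L)`, `L > 0`,
`H = hilbertTransform` in the variable `ξ`, convention `H cos = sin`): the exact, secular-term-free action of `H` on the frame
`e_n` of PRICE-impl1 §1 (E2). [folklore] -/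
theorem hilbertTransform_frame {L : ℝ} (hL : 0 < L) {n : ℕ} (hn : n ≠ 0) (x : ℝ) :
    hilbertTransform (fun ξ : ℝ =>
        (1 + Real.cos (2 * Real.arctan (ξ / L))) * Real.sin (n * (2 * Real.arctan (ξ / L)))) x =
      -((1 + Real.cos (2 * Real.arctan (x / L))) * Real.cos (n * (2 * Real.arctan (x / L)))) := by
  obtain ⟨m, rfl⟩ : ∃ m, n = m + 1 := ⟨n - 1, by omega⟩
  have e : (fun ξ : ℝ => (1 + Real.cos (2 * Real.arctan (ξ / L))) *
      Real.sin (((m + 1 : ℕ) : ℝ) * (2 * Real.arctan (ξ / L)))) = fun ξ : ℝ =>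
      (∑ j ∈ Finset.range (m + 1),
        ((2 * L ^ 2 * (m.choose j : ℝ) * (2 * L) ^ j * (-1) ^ (m - j) : ℝ) : ℂ) *
          (((L : ℂ) - I * ξ) ^ (j + 2))⁻¹).im := by
    funext ξ; exact frame_eq_im hL m ξ
  have h : hilbertTransform (fun ξ : ℝ => (∑ j ∈ Finset.range (m + 1),
        ((2 * L ^ 2 * (m.choose j : ℝ) * (2 * L) ^ j * (-1) ^ (m - j) : ℝ) : ℂ) *
          (((L : ℂ) - I * ξ) ^ (j + 2))⁻¹).im) x = -(∑ j ∈ Finset.range (m + 1),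
        ((2 * L ^ 2 * (m.choose j : ℝ) * (2 * L) ^ j * (-1) ^ (m - j) : ℝ) : ℂ) *
          (((L : ℂ) - I * x) ^ (j + 2))⁻¹).re :=
    (hilbertTransform_cayleySum hL (fun j => 2 * L ^ 2 * (m.choose j : ℝ) * (2 * L) ^ j * (-1) ^ (m - j))
      (m + 1) x).2
  rw [e, h, ← coframe_eq_re hL]

/-- **(E2), cosine companion: `H[(1 + cos θ) cos nθ] = (1 + cos θ) sin nθ = e_n`** for every `n ≥ 1` (`θ = 2·arctan(ξ/L)`,
`L > 0`). For `n = 0` this FAILS: `H[1 + cos θ] = sin θ ≠ 0` (`hilbertTransform_one_add_cos_cayleyAngle`). [folklore] -/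
theorem hilbertTransform_coframe {L : ℝ} (hL : 0 < L) {n : ℕ} (hn : n ≠ 0) (x : ℝ) :
    hilbertTransform (fun ξ : ℝ =>
        (1 + Real.cos (2 * Real.arctan (ξ / L))) * Real.cos (n * (2 * Real.arctan (ξ / L)))) x =
      (1 + Real.cos (2 * Real.arctan (x / L))) * Real.sin (n * (2 * Real.arctan (x / L))) := by
  obtain ⟨m, rfl⟩ : ∃ m, n = m + 1 := ⟨n - 1, by omega⟩
  have e : (fun ξ : ℝ => (1 + Real.cos (2 * Real.arctan (ξ / L))) *
      Real.cos (((m + 1 : ℕ) : ℝ) * (2 * Real.arctan (ξ / L)))) = fun ξ : ℝ =>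
      (∑ j ∈ Finset.range (m + 1),
        ((2 * L ^ 2 * (m.choose j : ℝ) * (2 * L) ^ j * (-1) ^ (m - j) : ℝ) : ℂ) *
          (((L : ℂ) - I * ξ) ^ (j + 2))⁻¹).re := by
    funext ξ; exact coframe_eq_re hL m ξ
  have h : hilbertTransform (fun ξ : ℝ => (∑ j ∈ Finset.range (m + 1),
        ((2 * L ^ 2 * (m.choose j : ℝ) * (2 * L) ^ j * (-1) ^ (m - j) : ℝ) : ℂ) *
          (((L : ℂ) - I * ξ) ^ (j + 2))⁻¹).re) x = (∑ j ∈ Finset.range (m + 1),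
        ((2 * L ^ 2 * (m.choose j : ℝ) * (2 * L) ^ j * (-1) ^ (m - j) : ℝ) : ℂ) *
          (((L : ℂ) - I * x) ^ (j + 2))⁻¹).im :=
    (hilbertTransform_cayleySum hL (fun j => 2 * L ^ 2 * (m.choose j : ℝ) * (2 * L) ^ j * (-1) ^ (m - j))
      (m + 1) x).1
  rw [e, h, ← frame_eq_im hL]

/-- The `n = 0` companion for completeness: **`H[1 + cos θ] = sin θ`** (`θ = 2·arctan(ξ/L)`), i.e. the Poisson pair
`H[2L²/(L² + ξ²)] = 2Lξ/(L² + ξ²)` — so the cosine clause of (E2) is sharp in `n ≥ 1`. [folklore] -/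
theorem hilbertTransform_one_add_cos_cayleyAngle {L : ℝ} (hL : 0 < L) (x : ℝ) :
    hilbertTransform (fun ξ : ℝ => 1 + Real.cos (2 * Real.arctan (ξ / L))) x = Real.sin (2 * Real.arctan (x / L)) := by
  have e : (fun ξ : ℝ => 1 + Real.cos (2 * Real.arctan (ξ / L))) = fun ξ => 2 * L * (L / (L ^ 2 + ξ ^ 2)) := by
    funext ξ
    rw [SheetRCayleySubstitution.one_add_cos_cayleyAngle hL.ne']
    have : L ^ 2 + ξ ^ 2 ≠ 0 := by positivity
    field_simp
  rw [e, hilbertTransform_const_mul, hilbertTransform_poissonKernel hL, SheetRCayleySubstitution.sin_cayleyAngle hL.ne']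
  have h1 : L ^ 2 + x ^ 2 ≠ 0 := by positivity
  field_simp

/-! ### §3 (E2), velocity clause, and the split-form spellings `lineHilbert` / `lineVelocity` -/

/-- **(E2), velocity clause: `𝒰e_n(ξ) = ∫₀^ξ H e_n = −(L/n)·sin nθ(ξ)`** (`n ≥ 1`, `L > 0`): (E2) plus cert-5's primitive
`∫₀^ξ (1 + cos θ)cos nθ = (L/n) sin nθ` (`SheetRCayleySubstitution.integral_one_add_cos_mul_cos_cayleyAngle`). [folklore] -/
theorem integral_hilbertTransform_frame {L : ℝ} (hL : 0 < L) {n : ℕ} (hn : n ≠ 0) (ξ : ℝ) :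
    ∫ s in (0 : ℝ)..ξ, hilbertTransform (fun y : ℝ =>
        (1 + Real.cos (2 * Real.arctan (y / L))) * Real.sin (n * (2 * Real.arctan (y / L)))) s =
      -(L / n) * Real.sin (n * (2 * Real.arctan (ξ / L))) := by
  simp only [hilbertTransform_frame hL hn]
  rw [intervalIntegral.integral_neg, SheetRCayleySubstitution.integral_one_add_cos_mul_cos_cayleyAngle hL.ne' hn]
  ring

/-- On the frame functions (which are `C¹ ∩ L¹`, cert-5 §4) the split-form operator `lineHilbert` of the gCLM files agrees with
`hilbertTransform`. [folklore] -/
theorem lineHilbert_frame_eq_hilbertTransform {L : ℝ} (hL : 0 < L) (n : ℕ) :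
    Literature.Analysis.FluidPDE.lineHilbert (fun ξ : ℝ =>
        (1 + Real.cos (2 * Real.arctan (ξ / L))) * Real.sin (n * (2 * Real.arctan (ξ / L)))) =
      hilbertTransform (fun ξ : ℝ =>
        (1 + Real.cos (2 * Real.arctan (ξ / L))) * Real.sin (n * (2 * Real.arctan (ξ / L)))) :=
  lineHilbert_eq_hilbertTransform_of_contDiff (SheetRCayleySubstitution.contDiff_frame L n)
    (SheetRCayleySubstitution.integrable_frame hL n)

/-- (E2) for `lineHilbert`: `lineHilbert e_n = −(1 + cos θ) cos nθ` (`n ≥ 1`). [folklore] -/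
theorem lineHilbert_frame {L : ℝ} (hL : 0 < L) {n : ℕ} (hn : n ≠ 0) (x : ℝ) :
    Literature.Analysis.FluidPDE.lineHilbert (fun ξ : ℝ =>
        (1 + Real.cos (2 * Real.arctan (ξ / L))) * Real.sin (n * (2 * Real.arctan (ξ / L)))) x =
      -((1 + Real.cos (2 * Real.arctan (x / L))) * Real.cos (n * (2 * Real.arctan (x / L)))) := by
  rw [lineHilbert_frame_eq_hilbertTransform hL n]
  exact hilbertTransform_frame hL hn x

/-- (E2), velocity clause, for the gCLM velocity `lineVelocity e_n = ∫₀^ξ lineHilbert e_n`: **`lineVelocity e_n = −(L/n)·sin nθ`**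
(`n ≥ 1`). [folklore] -/
theorem lineVelocity_frame {L : ℝ} (hL : 0 < L) {n : ℕ} (hn : n ≠ 0) (ξ : ℝ) :
    Literature.Analysis.FluidPDE.lineVelocity (fun y : ℝ =>
        (1 + Real.cos (2 * Real.arctan (y / L))) * Real.sin (n * (2 * Real.arctan (y / L)))) ξ =
      -(L / n) * Real.sin (n * (2 * Real.arctan (ξ / L))) := by
  rw [Literature.Analysis.FluidPDE.lineVelocity_def, lineHilbert_frame_eq_hilbertTransform hL n]
  exact integral_hilbertTransform_frame hL hn ξ

end SheetRCayleyHilbert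
end Summit.NavierStokesRegularity.OSWSelfSimilar
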